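import Summits.CriticalPhenomena.PercolationContinuityZ3.Theorems.Transplant.FKConnectivityAllQAntipodalAndGenSeries
import HarnessLib

/-!
# Connectivity correlation inequalities for `φ_{w,q}`, every `q > 0` — file 32W: the GENERAL SERIES JUNCTION IDENTITY for the AND-drift with a
# LEVEL WEIGHT (towards Conjecture AND⁺ / C_∞⁺ for the AND type)

Support file (`--supports stmt-CriticalPhenomena-4575`), FK sub-lane `prim-bschramm-fk-2` (gen 21); builds on p205010 (kernel theorem,
internal audit signed; external expert review pending).  No definitions, no named facts, no sorries; standard axioms.

File 32 (`…AndGenSeries.lean`, gen 19) proved, across a series junction `E₁(s,m) · E₂(m,t)`, the identity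
`q^{2|V|+1} 𝔞(γ) = σ̄₂ q^{K̄₂+Φ₂+1}(q^{Y₁+Φ̄₁} − q^{Ȳ₁+Φ₁}) + (1−σ̄₂) q^{K̄₂+Φ₂}(q^{K₁+Φ̄₁} − q^{K̄₁+Φ₁}) + σ₁ q^{K₁+Φ̄₁+1}(q^{Y₂+Φ̄₂} − q^{Ȳ₂+Φ₂})
 + (1−σ₁) q^{K₁+Φ̄₁}(q^{K₂+Φ̄₂} − q^{K̄₂+Φ₂})` for the summand `𝔞(γ) = q^{k(ω∪st)+k(φ̄)} − q^{k(ω̄∪st)+k(φ)}` of the general AND-drift.  Since it is an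
identity of signed monomials valid for every `q`, the exponents match termwise, and the same identity holds with `q^ℓ` replaced by `w(ℓ)` for an
ARBITRARY weight sequence `w : ℕ → ℝ` (`FK.andGenW_summand_series`; the factor `q^{2|V|+1}` becomes the shift `w ↦ w(· + 2|V| + 1)`, the factors
`q^{K̄₂+Φ₂+1}` etc. become shifts of the side weights).  Summing (`FK.andGenW_series_eq`) and using that the class of ANTITONE weights is
invariant under `w ↦ w(· + c)` and `w ↦ w(· − c)`: **`FK.andGenW_series_nonpos`** — if the weighted general AND-drifts of the two sides (with and
without their virtual roots) are `≤ 0` for every antitone weight and every monotone test function, so is the weighted drift of the composite.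
With files 32aW (parallel), 32bW (doubled root, landed as `…AndGenWeightSides`) and the induction of file 32c re-run with weights this yields
gen 17's Conjecture AND⁺ (the AND-drift polynomial `a_S(q)/(q−1)` has nonnegative coefficients) — memo FROM-fk-2-g21-QFREE §6.
[cite: Grimmett2006, §1.4 eq. (1.20) (p. 15); §3.8 Thm. (3.90) (pp. 61–62); §3.9 (pp. 63–64)] [cite: Wagner2006, Thm. 5.8(d), §5.3]
-/

noncomputable section

namespace Summit.CriticalPhenomena.PercolationContinuityZ3.Theorems

namespace FK

open SimpleGraph Literature.Probability.LatticeModels Literature.Probability.Percolation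
open scoped Classical

variable {V : Type*} [Fintype V]

section GenSeriesW

variable {E₁ E₂ : Finset (Sym2 V)} {V₁ V₂ : Set V} {s m t : V}

/-- Shifting an antitone weight keeps it antitone (upward shift). [folklore] -/
theorem antitoneW_add {w : ℕ → ℝ} (hw : ∀ n : ℕ, w (n + 1) ≤ w n) (c : ℕ) : ∀ n : ℕ, w (n + 1 + c) ≤ w (n + c) := fun n => by
  rw [Nat.add_right_comm]; exact hw (n + c)

/-- Shifting an antitone weight keeps it antitone (downward, truncated shift). [folklore] -/
theorem antitoneW_sub {w : ℕ → ℝ} (hw : ∀ n : ℕ, w (n + 1) ≤ w n) (c : ℕ) : ∀ n : ℕ, w (n + 1 - c) ≤ w (n - c) := fun n => by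
  rcases Nat.lt_or_ge n c with h | h
  · have e3 : n + 1 - c = n - c + 1 ∨ n + 1 - c = n - c := by omega
    rcases e3 with e3 | e3
    · rw [e3]; exact hw _
    · rw [e3]
  · have e : n + 1 - c = n - c + 1 := by omega
    rw [e]; exact hw _

set_option linter.unusedSimpArgs false in
/-- **THE GENERAL SERIES JUNCTION IDENTITY, WEIGHTED (pointwise).**  Notation of file 32 (`Kᵢ = k(ωᵢ)`, `Pᵢ = k(φᵢ)`, `Yᵢ` with the virtual root
inserted, bars for the complementary side); for every `w : ℕ → ℝ`:
`w(k(ω∪st)+k(φ̄)+2|V|+1) − w(k(ω̄∪st)+k(φ)+2|V|+1) = σ̄₂ [w(Y₁+P̄₁+c₁) − w(Ȳ₁+P₁+c₁)] + (1−σ̄₂)[w(K₁+P̄₁+c₀) − w(K̄₁+P₁+c₀)]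
 + σ₁ [w(Y₂+P̄₂+d₁) − w(Ȳ₂+P₂+d₁)] + (1−σ₁)[w(K₂+P̄₂+d₀) − w(K̄₂+P₂+d₀)]` with `c₁ = K̄₂+P₂+1`, `c₀ = K̄₂+P₂`, `d₁ = K₁+P̄₁+1`, `d₀ = K₁+P̄₁`.
[cite: Grimmett2006, §3.8 (pp. 61–62)] -/
theorem andGenW_summand_series (w : ℕ → ℝ) (h₁ : ∀ e ∈ (↑E₁ : Set (Sym2 V)), ∀ z ∈ e, z ∈ V₁)
    (h₂ : ∀ e ∈ (↑E₂ : Set (Sym2 V)), ∀ z ∈ e, z ∈ V₂) (hS : V₁ ∩ V₂ ⊆ {m}) (hsV₂ : s ∉ V₂) (htV₁ : t ∉ V₁)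
    (hsm : s ≠ m) (htm : t ≠ m) (hst : s ≠ t)
    {N₁ A₁ C₁ N₂ A₂ C₂ γ₁ γ₂ : Finset (Sym2 V)} (hN₁ : N₁ ⊆ E₁) (hA₁ : A₁ ⊆ E₁) (hC₁ : C₁ ⊆ E₁)
    (hN₂ : N₂ ⊆ E₂) (hA₂ : A₂ ⊆ E₂) (hC₂ : C₂ ⊆ E₂) (hγ₁ : γ₁ ⊆ N₁) (hγ₂ : γ₂ ⊆ N₂) (x : ℝ) :
    (w (clusterCount (↑(insert s(s, t) ((γ₁ ∪ A₁) ∪ (γ₂ ∪ A₂))) : BondConfig V) ∅ +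
            clusterCount (↑((N₁ \ γ₁ ∪ C₁) ∪ (N₂ \ γ₂ ∪ C₂)) : BondConfig V) ∅ + (2 * Fintype.card V + 1)) -
        w (clusterCount (↑(insert s(s, t) ((N₁ \ γ₁ ∪ A₁) ∪ (N₂ \ γ₂ ∪ A₂))) : BondConfig V) ∅ +
            clusterCount (↑((γ₁ ∪ C₁) ∪ (γ₂ ∪ C₂)) : BondConfig V) ∅ + (2 * Fintype.card V + 1))) * x =
      (if (openGraph (↑(N₂ \ γ₂ ∪ A₂) : BondConfig V)).Reachable m t then 1 else 0) *
          ((w (clusterCount (↑(insert s(s, m) (γ₁ ∪ A₁)) : BondConfig V) ∅ + clusterCount (↑(N₁ \ γ₁ ∪ C₁) : BondConfig V) ∅ +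
                (clusterCount (↑(N₂ \ γ₂ ∪ A₂) : BondConfig V) ∅ + clusterCount (↑(γ₂ ∪ C₂) : BondConfig V) ∅ + 1)) -
            w (clusterCount (↑(insert s(s, m) (N₁ \ γ₁ ∪ A₁)) : BondConfig V) ∅ + clusterCount (↑(γ₁ ∪ C₁) : BondConfig V) ∅ +
                (clusterCount (↑(N₂ \ γ₂ ∪ A₂) : BondConfig V) ∅ + clusterCount (↑(γ₂ ∪ C₂) : BondConfig V) ∅ + 1))) * x) +
      (if (openGraph (↑(N₂ \ γ₂ ∪ A₂) : BondConfig V)).Reachable m t then 0 else 1) *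
          ((w (clusterCount (↑(γ₁ ∪ A₁) : BondConfig V) ∅ + clusterCount (↑(N₁ \ γ₁ ∪ C₁) : BondConfig V) ∅ +
                (clusterCount (↑(N₂ \ γ₂ ∪ A₂) : BondConfig V) ∅ + clusterCount (↑(γ₂ ∪ C₂) : BondConfig V) ∅)) -
            w (clusterCount (↑(N₁ \ γ₁ ∪ A₁) : BondConfig V) ∅ + clusterCount (↑(γ₁ ∪ C₁) : BondConfig V) ∅ +
                (clusterCount (↑(N₂ \ γ₂ ∪ A₂) : BondConfig V) ∅ + clusterCount (↑(γ₂ ∪ C₂) : BondConfig V) ∅))) * x) +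
      (if (openGraph (↑(γ₁ ∪ A₁) : BondConfig V)).Reachable s m then 1 else 0) *
          ((w (clusterCount (↑(insert s(m, t) (γ₂ ∪ A₂)) : BondConfig V) ∅ + clusterCount (↑(N₂ \ γ₂ ∪ C₂) : BondConfig V) ∅ +
                (clusterCount (↑(γ₁ ∪ A₁) : BondConfig V) ∅ + clusterCount (↑(N₁ \ γ₁ ∪ C₁) : BondConfig V) ∅ + 1)) -
            w (clusterCount (↑(insert s(m, t) (N₂ \ γ₂ ∪ A₂)) : BondConfig V) ∅ + clusterCount (↑(γ₂ ∪ C₂) : BondConfig V) ∅ +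
                (clusterCount (↑(γ₁ ∪ A₁) : BondConfig V) ∅ + clusterCount (↑(N₁ \ γ₁ ∪ C₁) : BondConfig V) ∅ + 1))) * x) +
      (if (openGraph (↑(γ₁ ∪ A₁) : BondConfig V)).Reachable s m then 0 else 1) *
          ((w (clusterCount (↑(γ₂ ∪ A₂) : BondConfig V) ∅ + clusterCount (↑(N₂ \ γ₂ ∪ C₂) : BondConfig V) ∅ +
                (clusterCount (↑(γ₁ ∪ A₁) : BondConfig V) ∅ + clusterCount (↑(N₁ \ γ₁ ∪ C₁) : BondConfig V) ∅)) -
            w (clusterCount (↑(N₂ \ γ₂ ∪ A₂) : BondConfig V) ∅ + clusterCount (↑(γ₂ ∪ C₂) : BondConfig V) ∅ +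
                (clusterCount (↑(γ₁ ∪ A₁) : BondConfig V) ∅ + clusterCount (↑(N₁ \ γ₁ ∪ C₁) : BondConfig V) ∅))) * x) := by
  -- containments of the attached configurations
  have hω₁ : γ₁ ∪ A₁ ⊆ E₁ := Finset.union_subset (hγ₁.trans hN₁) hA₁
  have hωb₁ : N₁ \ γ₁ ∪ A₁ ⊆ E₁ := Finset.union_subset (Finset.sdiff_subset.trans hN₁) hA₁
  have hω₂ : γ₂ ∪ A₂ ⊆ E₂ := Finset.union_subset (hγ₂.trans hN₂) hA₂
  have hωb₂ : N₂ \ γ₂ ∪ A₂ ⊆ E₂ := Finset.union_subset (Finset.sdiff_subset.trans hN₂) hA₂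
  have hφ₁ : γ₁ ∪ C₁ ⊆ E₁ := Finset.union_subset (hγ₁.trans hN₁) hC₁
  have hφb₁ : N₁ \ γ₁ ∪ C₁ ⊆ E₁ := Finset.union_subset (Finset.sdiff_subset.trans hN₁) hC₁
  have hφ₂ : γ₂ ∪ C₂ ⊆ E₂ := Finset.union_subset (hγ₂.trans hN₂) hC₂
  have hφb₂ : N₂ \ γ₂ ∪ C₂ ⊆ E₂ := Finset.union_subset (Finset.sdiff_subset.trans hN₂) hC₂
  -- junction bookkeeping
  have eS := clusterCount_junction_genSeries h₁ h₂ hS hsV₂ htV₁ hsm htm hst hω₁ hω₂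
  have eSb := clusterCount_junction_genSeries h₁ h₂ hS hsV₂ htV₁ hsm htm hst hωb₁ hωb₂
  have eC := clusterCount_union_series h₁ h₂ hS hφb₁ hφb₂
  have eG := clusterCount_union_series h₁ h₂ hS hφ₁ hφ₂
  have y₁ := clusterCount_insert_add_ite (γ₁ ∪ A₁) s m
  have yb₁ := clusterCount_insert_add_ite (N₁ \ γ₁ ∪ A₁) s m
  have y₂ := clusterCount_insert_add_ite (γ₂ ∪ A₂) m t
  have yb₂ := clusterCount_insert_add_ite (N₂ \ γ₂ ∪ A₂) m t
  -- atoms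
  set KS := clusterCount (↑(insert s(s, t) ((γ₁ ∪ A₁) ∪ (γ₂ ∪ A₂))) : BondConfig V) ∅
  set KSb := clusterCount (↑(insert s(s, t) ((N₁ \ γ₁ ∪ A₁) ∪ (N₂ \ γ₂ ∪ A₂))) : BondConfig V) ∅
  set KC := clusterCount (↑((N₁ \ γ₁ ∪ C₁) ∪ (N₂ \ γ₂ ∪ C₂)) : BondConfig V) ∅
  set KG := clusterCount (↑((γ₁ ∪ C₁) ∪ (γ₂ ∪ C₂)) : BondConfig V) ∅
  set K₁ := clusterCount (↑(γ₁ ∪ A₁) : BondConfig V) ∅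
  set Kb₁ := clusterCount (↑(N₁ \ γ₁ ∪ A₁) : BondConfig V) ∅
  set K₂ := clusterCount (↑(γ₂ ∪ A₂) : BondConfig V) ∅
  set Kb₂ := clusterCount (↑(N₂ \ γ₂ ∪ A₂) : BondConfig V) ∅
  set P₁ := clusterCount (↑(γ₁ ∪ C₁) : BondConfig V) ∅
  set Pb₁ := clusterCount (↑(N₁ \ γ₁ ∪ C₁) : BondConfig V) ∅
  set P₂ := clusterCount (↑(γ₂ ∪ C₂) : BondConfig V) ∅
  set Pb₂ := clusterCount (↑(N₂ \ γ₂ ∪ C₂) : BondConfig V) ∅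
  set Y₁ := clusterCount (↑(insert s(s, m) (γ₁ ∪ A₁)) : BondConfig V) ∅
  set Yb₁ := clusterCount (↑(insert s(s, m) (N₁ \ γ₁ ∪ A₁)) : BondConfig V) ∅
  set Y₂ := clusterCount (↑(insert s(m, t) (γ₂ ∪ A₂)) : BondConfig V) ∅
  set Yb₂ := clusterCount (↑(insert s(m, t) (N₂ \ γ₂ ∪ A₂)) : BondConfig V) ∅
  -- the active terms telescope: (t3 or t4) + (t1 or t2)
  by_cases r₁ : (openGraph (↑(γ₁ ∪ A₁) : BondConfig V)).Reachable s m <;>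
  by_cases rb₂ : (openGraph (↑(N₂ \ γ₂ ∪ A₂) : BondConfig V)).Reachable m t <;>
  by_cases rb₁ : (openGraph (↑(N₁ \ γ₁ ∪ A₁) : BondConfig V)).Reachable s m <;>
  by_cases r₂ : (openGraph (↑(γ₂ ∪ A₂) : BondConfig V)).Reachable m t <;>
  simp only [r₁, rb₁, r₂, rb₂, and_self, and_true, true_and, and_false, false_and, if_true, if_false,
    not_false_eq_true, not_true_eq_false, add_zero, one_mul, zero_mul, zero_add] at y₁ yb₁ y₂ yb₂ eS eSb ⊢
  -- case r₁, rb₂ : terms t3 + t1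
  · rw [show KS + KC + (2 * Fintype.card V + 1) = Y₂ + Pb₂ + (K₁ + Pb₁ + 1) by omega,
      show Yb₂ + P₂ + (K₁ + Pb₁ + 1) = Y₁ + Pb₁ + (Kb₂ + P₂ + 1) by omega,
      show KSb + KG + (2 * Fintype.card V + 1) = Yb₁ + P₁ + (Kb₂ + P₂ + 1) by omega]; ring
  · rw [show KS + KC + (2 * Fintype.card V + 1) = Y₂ + Pb₂ + (K₁ + Pb₁ + 1) by omega,
      show Yb₂ + P₂ + (K₁ + Pb₁ + 1) = Y₁ + Pb₁ + (Kb₂ + P₂ + 1) by omega,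
      show KSb + KG + (2 * Fintype.card V + 1) = Yb₁ + P₁ + (Kb₂ + P₂ + 1) by omega]; ring
  · rw [show KS + KC + (2 * Fintype.card V + 1) = Y₂ + Pb₂ + (K₁ + Pb₁ + 1) by omega,
      show Yb₂ + P₂ + (K₁ + Pb₁ + 1) = Y₁ + Pb₁ + (Kb₂ + P₂ + 1) by omega,
      show KSb + KG + (2 * Fintype.card V + 1) = Yb₁ + P₁ + (Kb₂ + P₂ + 1) by omega]; ring
  · rw [show KS + KC + (2 * Fintype.card V + 1) = Y₂ + Pb₂ + (K₁ + Pb₁ + 1) by omega,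
      show Yb₂ + P₂ + (K₁ + Pb₁ + 1) = Y₁ + Pb₁ + (Kb₂ + P₂ + 1) by omega,
      show KSb + KG + (2 * Fintype.card V + 1) = Yb₁ + P₁ + (Kb₂ + P₂ + 1) by omega]; ring
  -- case r₁, ¬rb₂ : terms t3 + t2
  · rw [show KS + KC + (2 * Fintype.card V + 1) = Y₂ + Pb₂ + (K₁ + Pb₁ + 1) by omega,
      show Yb₂ + P₂ + (K₁ + Pb₁ + 1) = K₁ + Pb₁ + (Kb₂ + P₂) by omega,
      show KSb + KG + (2 * Fintype.card V + 1) = Kb₁ + P₁ + (Kb₂ + P₂) by omega]; ring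
  · rw [show KS + KC + (2 * Fintype.card V + 1) = Y₂ + Pb₂ + (K₁ + Pb₁ + 1) by omega,
      show Yb₂ + P₂ + (K₁ + Pb₁ + 1) = K₁ + Pb₁ + (Kb₂ + P₂) by omega,
      show KSb + KG + (2 * Fintype.card V + 1) = Kb₁ + P₁ + (Kb₂ + P₂) by omega]; ring
  · rw [show KS + KC + (2 * Fintype.card V + 1) = Y₂ + Pb₂ + (K₁ + Pb₁ + 1) by omega,
      show Yb₂ + P₂ + (K₁ + Pb₁ + 1) = K₁ + Pb₁ + (Kb₂ + P₂) by omega,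
      show KSb + KG + (2 * Fintype.card V + 1) = Kb₁ + P₁ + (Kb₂ + P₂) by omega]; ring
  · rw [show KS + KC + (2 * Fintype.card V + 1) = Y₂ + Pb₂ + (K₁ + Pb₁ + 1) by omega,
      show Yb₂ + P₂ + (K₁ + Pb₁ + 1) = K₁ + Pb₁ + (Kb₂ + P₂) by omega,
      show KSb + KG + (2 * Fintype.card V + 1) = Kb₁ + P₁ + (Kb₂ + P₂) by omega]; ring
  -- case ¬r₁, rb₂ : terms t4 + t1
  · rw [show KS + KC + (2 * Fintype.card V + 1) = K₂ + Pb₂ + (K₁ + Pb₁) by omega,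
      show Kb₂ + P₂ + (K₁ + Pb₁) = Y₁ + Pb₁ + (Kb₂ + P₂ + 1) by omega,
      show KSb + KG + (2 * Fintype.card V + 1) = Yb₁ + P₁ + (Kb₂ + P₂ + 1) by omega]; ring
  · rw [show KS + KC + (2 * Fintype.card V + 1) = K₂ + Pb₂ + (K₁ + Pb₁) by omega,
      show Kb₂ + P₂ + (K₁ + Pb₁) = Y₁ + Pb₁ + (Kb₂ + P₂ + 1) by omega,
      show KSb + KG + (2 * Fintype.card V + 1) = Yb₁ + P₁ + (Kb₂ + P₂ + 1) by omega]; ring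
  · rw [show KS + KC + (2 * Fintype.card V + 1) = K₂ + Pb₂ + (K₁ + Pb₁) by omega,
      show Kb₂ + P₂ + (K₁ + Pb₁) = Y₁ + Pb₁ + (Kb₂ + P₂ + 1) by omega,
      show KSb + KG + (2 * Fintype.card V + 1) = Yb₁ + P₁ + (Kb₂ + P₂ + 1) by omega]; ring
  · rw [show KS + KC + (2 * Fintype.card V + 1) = K₂ + Pb₂ + (K₁ + Pb₁) by omega,
      show Kb₂ + P₂ + (K₁ + Pb₁) = Y₁ + Pb₁ + (Kb₂ + P₂ + 1) by omega,
      show KSb + KG + (2 * Fintype.card V + 1) = Yb₁ + P₁ + (Kb₂ + P₂ + 1) by omega]; ring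
  -- case ¬r₁, ¬rb₂ : terms t4 + t2
  · rw [show KS + KC + (2 * Fintype.card V + 1) = K₂ + Pb₂ + (K₁ + Pb₁) by omega,
      show Kb₂ + P₂ + (K₁ + Pb₁) = K₁ + Pb₁ + (Kb₂ + P₂) by omega,
      show KSb + KG + (2 * Fintype.card V + 1) = Kb₁ + P₁ + (Kb₂ + P₂) by omega]; ring
  · rw [show KS + KC + (2 * Fintype.card V + 1) = K₂ + Pb₂ + (K₁ + Pb₁) by omega,
      show Kb₂ + P₂ + (K₁ + Pb₁) = K₁ + Pb₁ + (Kb₂ + P₂) by omega,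
      show KSb + KG + (2 * Fintype.card V + 1) = Kb₁ + P₁ + (Kb₂ + P₂) by omega]; ring
  · rw [show KS + KC + (2 * Fintype.card V + 1) = K₂ + Pb₂ + (K₁ + Pb₁) by omega,
      show Kb₂ + P₂ + (K₁ + Pb₁) = K₁ + Pb₁ + (Kb₂ + P₂) by omega,
      show KSb + KG + (2 * Fintype.card V + 1) = Kb₁ + P₁ + (Kb₂ + P₂) by omega]; ring
  · rw [show KS + KC + (2 * Fintype.card V + 1) = K₂ + Pb₂ + (K₁ + Pb₁) by omega,
      show Kb₂ + P₂ + (K₁ + Pb₁) = K₁ + Pb₁ + (Kb₂ + P₂) by omega,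
      show KSb + KG + (2 * Fintype.card V + 1) = Kb₁ + P₁ + (Kb₂ + P₂) by omega]; ring

/-- **THE GENERAL SERIES JUNCTION IDENTITY, WEIGHTED (summed).** [cite: Grimmett2006, §3.8 Thm. (3.90) (pp. 61–62)] -/
theorem andGenW_series_eq (w : ℕ → ℝ) (h₁ : ∀ e ∈ (↑E₁ : Set (Sym2 V)), ∀ z ∈ e, z ∈ V₁)
    (h₂ : ∀ e ∈ (↑E₂ : Set (Sym2 V)), ∀ z ∈ e, z ∈ V₂) (hS : V₁ ∩ V₂ ⊆ {m}) (hsV₂ : s ∉ V₂) (htV₁ : t ∉ V₁)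
    (hsm : s ≠ m) (htm : t ≠ m) (hst : s ≠ t)
    {N₁ A₁ C₁ N₂ A₂ C₂ : Finset (Sym2 V)} (hd : Disjoint N₁ N₂) (hN₁ : N₁ ⊆ E₁) (hA₁ : A₁ ⊆ E₁) (hC₁ : C₁ ⊆ E₁)
    (hN₂ : N₂ ⊆ E₂) (hA₂ : A₂ ⊆ E₂) (hC₂ : C₂ ⊆ E₂) (g : Finset (Sym2 V) → ℝ) :
    ∑ γ ∈ (N₁ ∪ N₂).powerset,
        (w (clusterCount (↑(insert s(s, t) (γ ∪ (A₁ ∪ A₂))) : BondConfig V) ∅ +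
              clusterCount (↑((N₁ ∪ N₂) \ γ ∪ (C₁ ∪ C₂)) : BondConfig V) ∅ + (2 * Fintype.card V + 1)) -
          w (clusterCount (↑(insert s(s, t) ((N₁ ∪ N₂) \ γ ∪ (A₁ ∪ A₂))) : BondConfig V) ∅ +
              clusterCount (↑(γ ∪ (C₁ ∪ C₂)) : BondConfig V) ∅ + (2 * Fintype.card V + 1))) * g γ =
      ∑ γ₂ ∈ N₂.powerset,
          ((if (openGraph (↑(N₂ \ γ₂ ∪ A₂) : BondConfig V)).Reachable m t then 1 else 0) *
              ∑ γ₁ ∈ N₁.powerset,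
                (w (clusterCount (↑(insert s(s, m) (γ₁ ∪ A₁)) : BondConfig V) ∅ + clusterCount (↑(N₁ \ γ₁ ∪ C₁) : BondConfig V) ∅ +
                      (clusterCount (↑(N₂ \ γ₂ ∪ A₂) : BondConfig V) ∅ + clusterCount (↑(γ₂ ∪ C₂) : BondConfig V) ∅ + 1)) -
                  w (clusterCount (↑(insert s(s, m) (N₁ \ γ₁ ∪ A₁)) : BondConfig V) ∅ + clusterCount (↑(γ₁ ∪ C₁) : BondConfig V) ∅ +
                      (clusterCount (↑(N₂ \ γ₂ ∪ A₂) : BondConfig V) ∅ + clusterCount (↑(γ₂ ∪ C₂) : BondConfig V) ∅ + 1))) *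
                  g (γ₁ ∪ γ₂) +
            (if (openGraph (↑(N₂ \ γ₂ ∪ A₂) : BondConfig V)).Reachable m t then 0 else 1) *
              ∑ γ₁ ∈ N₁.powerset,
                (w (clusterCount (↑(γ₁ ∪ A₁) : BondConfig V) ∅ + clusterCount (↑(N₁ \ γ₁ ∪ C₁) : BondConfig V) ∅ +
                      (clusterCount (↑(N₂ \ γ₂ ∪ A₂) : BondConfig V) ∅ + clusterCount (↑(γ₂ ∪ C₂) : BondConfig V) ∅)) -
                  w (clusterCount (↑(N₁ \ γ₁ ∪ A₁) : BondConfig V) ∅ + clusterCount (↑(γ₁ ∪ C₁) : BondConfig V) ∅ +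
                      (clusterCount (↑(N₂ \ γ₂ ∪ A₂) : BondConfig V) ∅ + clusterCount (↑(γ₂ ∪ C₂) : BondConfig V) ∅))) *
                  g (γ₁ ∪ γ₂)) +
        ∑ γ₁ ∈ N₁.powerset,
          ((if (openGraph (↑(γ₁ ∪ A₁) : BondConfig V)).Reachable s m then 1 else 0) *
              ∑ γ₂ ∈ N₂.powerset,
                (w (clusterCount (↑(insert s(m, t) (γ₂ ∪ A₂)) : BondConfig V) ∅ + clusterCount (↑(N₂ \ γ₂ ∪ C₂) : BondConfig V) ∅ +
                      (clusterCount (↑(γ₁ ∪ A₁) : BondConfig V) ∅ + clusterCount (↑(N₁ \ γ₁ ∪ C₁) : BondConfig V) ∅ + 1)) -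
                  w (clusterCount (↑(insert s(m, t) (N₂ \ γ₂ ∪ A₂)) : BondConfig V) ∅ + clusterCount (↑(γ₂ ∪ C₂) : BondConfig V) ∅ +
                      (clusterCount (↑(γ₁ ∪ A₁) : BondConfig V) ∅ + clusterCount (↑(N₁ \ γ₁ ∪ C₁) : BondConfig V) ∅ + 1))) *
                  g (γ₁ ∪ γ₂) +
            (if (openGraph (↑(γ₁ ∪ A₁) : BondConfig V)).Reachable s m then 0 else 1) *
              ∑ γ₂ ∈ N₂.powerset,
                (w (clusterCount (↑(γ₂ ∪ A₂) : BondConfig V) ∅ + clusterCount (↑(N₂ \ γ₂ ∪ C₂) : BondConfig V) ∅ +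
                      (clusterCount (↑(γ₁ ∪ A₁) : BondConfig V) ∅ + clusterCount (↑(N₁ \ γ₁ ∪ C₁) : BondConfig V) ∅)) -
                  w (clusterCount (↑(N₂ \ γ₂ ∪ A₂) : BondConfig V) ∅ + clusterCount (↑(γ₂ ∪ C₂) : BondConfig V) ∅ +
                      (clusterCount (↑(γ₁ ∪ A₁) : BondConfig V) ∅ + clusterCount (↑(N₁ \ γ₁ ∪ C₁) : BondConfig V) ∅))) *
                  g (γ₁ ∪ γ₂)) := by
  rw [sum_powerset_union_disj hd]
  simp_rw [Finset.mul_sum, ← Finset.sum_add_distrib]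
  rw [Finset.sum_comm (s := N₂.powerset) (t := N₁.powerset), ← Finset.sum_add_distrib]
  refine Finset.sum_congr rfl fun γ₁ hγ₁ => ?_
  rw [← Finset.sum_add_distrib]
  refine Finset.sum_congr rfl fun γ₂ hγ₂ => ?_
  rw [Finset.mem_powerset] at hγ₁ hγ₂
  rw [union_sdiff_union hd hγ₁ hγ₂, Finset.union_union_union_comm γ₁ γ₂ A₁ A₂,
    Finset.union_union_union_comm (N₁ \ γ₁) (N₂ \ γ₂) C₁ C₂, Finset.union_union_union_comm (N₁ \ γ₁) (N₂ \ γ₂) A₁ A₂,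
    Finset.union_union_union_comm γ₁ γ₂ C₁ C₂,
    andGenW_summand_series w h₁ h₂ hS hsV₂ htV₁ hsm htm hst hN₁ hA₁ hC₁ hN₂ hA₂ hC₂ hγ₁ hγ₂ (g (γ₁ ∪ γ₂))]
  ring

/-- **The weighted general AND-drift across a series junction (abstract form, ANTITONE weights).**  If on side 1 the weighted general AND-drifts
with root `sm` and without root (attached `A₁`, contracted `C₁`) are `≤ 0` for EVERY antitone weight and every monotone test function, and likewise
on side 2 with root `mt`, then the weighted general AND-drift of the composite with root `st` (attached `A₁ ∪ A₂`, contracted `C₁ ∪ C₂`) is `≤ 0`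
for every antitone weight and every monotone `g`. [cite: Grimmett2006, §3.8 Thm. (3.90) (pp. 61–62)] -/
theorem andGenW_series_nonpos (h₁ : ∀ e ∈ (↑E₁ : Set (Sym2 V)), ∀ z ∈ e, z ∈ V₁)
    (h₂ : ∀ e ∈ (↑E₂ : Set (Sym2 V)), ∀ z ∈ e, z ∈ V₂) (hS : V₁ ∩ V₂ ⊆ {m}) (hsV₂ : s ∉ V₂) (htV₁ : t ∉ V₁)
    (hsm : s ≠ m) (htm : t ≠ m) (hst : s ≠ t)
    {N₁ A₁ C₁ N₂ A₂ C₂ : Finset (Sym2 V)} (hd : Disjoint N₁ N₂) (hN₁ : N₁ ⊆ E₁) (hA₁ : A₁ ⊆ E₁) (hC₁ : C₁ ⊆ E₁)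
    (hN₂ : N₂ ⊆ E₂) (hA₂ : A₂ ⊆ E₂) (hC₂ : C₂ ⊆ E₂)
    (hY₁ : ∀ w' : ℕ → ℝ, (∀ n : ℕ, w' (n + 1) ≤ w' n) → ∀ h' : Finset (Sym2 V) → ℝ,
      (∀ ⦃A B : Finset (Sym2 V)⦄, A ⊆ B → B ⊆ N₁ → h' A ≤ h' B) →
      ∑ γ₁ ∈ N₁.powerset, (w' (clusterCount (↑(insert s(s, m) (γ₁ ∪ A₁)) : BondConfig V) ∅ + clusterCount (↑(N₁ \ γ₁ ∪ C₁) : BondConfig V) ∅) -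
        w' (clusterCount (↑(insert s(s, m) (N₁ \ γ₁ ∪ A₁)) : BondConfig V) ∅ + clusterCount (↑(γ₁ ∪ C₁) : BondConfig V) ∅)) * h' γ₁ ≤ 0)
    (hL₁ : ∀ w' : ℕ → ℝ, (∀ n : ℕ, w' (n + 1) ≤ w' n) → ∀ h' : Finset (Sym2 V) → ℝ,
      (∀ ⦃A B : Finset (Sym2 V)⦄, A ⊆ B → B ⊆ N₁ → h' A ≤ h' B) →
      ∑ γ₁ ∈ N₁.powerset, (w' (clusterCount (↑(γ₁ ∪ A₁) : BondConfig V) ∅ + clusterCount (↑(N₁ \ γ₁ ∪ C₁) : BondConfig V) ∅) -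
        w' (clusterCount (↑(N₁ \ γ₁ ∪ A₁) : BondConfig V) ∅ + clusterCount (↑(γ₁ ∪ C₁) : BondConfig V) ∅)) * h' γ₁ ≤ 0)
    (hY₂ : ∀ w' : ℕ → ℝ, (∀ n : ℕ, w' (n + 1) ≤ w' n) → ∀ h' : Finset (Sym2 V) → ℝ,
      (∀ ⦃A B : Finset (Sym2 V)⦄, A ⊆ B → B ⊆ N₂ → h' A ≤ h' B) →
      ∑ γ₂ ∈ N₂.powerset, (w' (clusterCount (↑(insert s(m, t) (γ₂ ∪ A₂)) : BondConfig V) ∅ + clusterCount (↑(N₂ \ γ₂ ∪ C₂) : BondConfig V) ∅) -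
        w' (clusterCount (↑(insert s(m, t) (N₂ \ γ₂ ∪ A₂)) : BondConfig V) ∅ + clusterCount (↑(γ₂ ∪ C₂) : BondConfig V) ∅)) * h' γ₂ ≤ 0)
    (hL₂ : ∀ w' : ℕ → ℝ, (∀ n : ℕ, w' (n + 1) ≤ w' n) → ∀ h' : Finset (Sym2 V) → ℝ,
      (∀ ⦃A B : Finset (Sym2 V)⦄, A ⊆ B → B ⊆ N₂ → h' A ≤ h' B) →
      ∑ γ₂ ∈ N₂.powerset, (w' (clusterCount (↑(γ₂ ∪ A₂) : BondConfig V) ∅ + clusterCount (↑(N₂ \ γ₂ ∪ C₂) : BondConfig V) ∅) -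
        w' (clusterCount (↑(N₂ \ γ₂ ∪ A₂) : BondConfig V) ∅ + clusterCount (↑(γ₂ ∪ C₂) : BondConfig V) ∅)) * h' γ₂ ≤ 0)
    {w : ℕ → ℝ} (hw : ∀ n : ℕ, w (n + 1) ≤ w n)
    {g : Finset (Sym2 V) → ℝ} (hmono : ∀ ⦃A B : Finset (Sym2 V)⦄, A ⊆ B → B ⊆ N₁ ∪ N₂ → g A ≤ g B) :
    ∑ γ ∈ (N₁ ∪ N₂).powerset,
        (w (clusterCount (↑(insert s(s, t) (γ ∪ (A₁ ∪ A₂))) : BondConfig V) ∅ +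
              clusterCount (↑((N₁ ∪ N₂) \ γ ∪ (C₁ ∪ C₂)) : BondConfig V) ∅) -
          w (clusterCount (↑(insert s(s, t) ((N₁ ∪ N₂) \ γ ∪ (A₁ ∪ A₂))) : BondConfig V) ∅ +
              clusterCount (↑(γ ∪ (C₁ ∪ C₂)) : BondConfig V) ∅)) * g γ ≤ 0 := by
  -- pass to the shifted weight `n ↦ w(n − T)`, `T = 2|V| + 1`, for which the junction identity is additive
  have key := andGenW_series_eq (fun k => w (k - (2 * Fintype.card V + 1))) h₁ h₂ hS hsV₂ htV₁ hsm htm hst hd hN₁ hA₁ hC₁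
    hN₂ hA₂ hC₂ g
  simp only [Nat.add_sub_cancel] at key
  rw [key]
  have sec₁ : ∀ γ₂ ∈ N₂.powerset, ∀ ⦃A B : Finset (Sym2 V)⦄, A ⊆ B → B ⊆ N₁ → g (A ∪ γ₂) ≤ g (B ∪ γ₂) := by
    intro γ₂ hγ₂ A B hAB hB
    rw [Finset.mem_powerset] at hγ₂
    exact hmono (Finset.union_subset_union hAB le_rfl) (Finset.union_subset_union hB hγ₂)
  have sec₂ : ∀ γ₁ ∈ N₁.powerset, ∀ ⦃A B : Finset (Sym2 V)⦄, A ⊆ B → B ⊆ N₂ → g (γ₁ ∪ A) ≤ g (γ₁ ∪ B) := by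
    intro γ₁ hγ₁ A B hAB hB
    rw [Finset.mem_powerset] at hγ₁
    exact hmono (Finset.union_subset_union le_rfl hAB) (Finset.union_subset_union hγ₁ hB)
  have shift : ∀ c : ℕ, ∀ n : ℕ, w (n + 1 + c - (2 * Fintype.card V + 1)) ≤ w (n + c - (2 * Fintype.card V + 1)) := fun c n => by
    have := antitoneW_sub hw (2 * Fintype.card V + 1) (n + c)
    rw [Nat.add_right_comm n 1 c]
    exact this
  refine add_nonpos (Finset.sum_nonpos fun γ₂ hγ₂ => ?_) (Finset.sum_nonpos fun γ₁ hγ₁ => ?_)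
  · set c₂ := clusterCount (↑(N₂ \ γ₂ ∪ A₂) : BondConfig V) ∅ + clusterCount (↑(γ₂ ∪ C₂) : BondConfig V) ∅ with hc₂
    have i₁ := hY₁ (fun n => w (n + (c₂ + 1) - (2 * Fintype.card V + 1))) (shift (c₂ + 1)) (fun γ₁ => g (γ₁ ∪ γ₂)) (sec₁ γ₂ hγ₂)
    have i₂ := hL₁ (fun n => w (n + c₂ - (2 * Fintype.card V + 1))) (shift c₂) (fun γ₁ => g (γ₁ ∪ γ₂)) (sec₁ γ₂ hγ₂)
    refine add_nonpos (mul_nonpos_of_nonneg_of_nonpos ?_ i₁) (mul_nonpos_of_nonneg_of_nonpos ?_ i₂) <;>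
    split_ifs <;> norm_num
  · set c₁ := clusterCount (↑(γ₁ ∪ A₁) : BondConfig V) ∅ + clusterCount (↑(N₁ \ γ₁ ∪ C₁) : BondConfig V) ∅ with hc₁
    have i₁ := hY₂ (fun n => w (n + (c₁ + 1) - (2 * Fintype.card V + 1))) (shift (c₁ + 1)) (fun γ₂ => g (γ₁ ∪ γ₂)) (sec₂ γ₁ hγ₁)
    have i₂ := hL₂ (fun n => w (n + c₁ - (2 * Fintype.card V + 1))) (shift c₁) (fun γ₂ => g (γ₁ ∪ γ₂)) (sec₂ γ₁ hγ₁)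
    refine add_nonpos (mul_nonpos_of_nonneg_of_nonpos ?_ i₁) (mul_nonpos_of_nonneg_of_nonpos ?_ i₂) <;>
    split_ifs <;> norm_num

end GenSeriesW

end FK

end Summit.CriticalPhenomena.PercolationContinuityZ3.Theorems

end
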